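import Mathlib
import Summits.ValiantsHypothesis.ValiantsHypothesis.Theorems.NewtonUnitEquationsDissociatedUniformTotalsLawUnion
import Summits.ValiantsHypothesis.ValiantsHypothesis.Theorems.NewtonUnitEquationsDissociatedUniformTotalsLawUnionConverse
import Summits.ValiantsHypothesis.ValiantsHypothesis.Theorems.NewtonUnitEquationsDissociatedUniformTotalsLawUnionVertLowerGrid
import Summits.ValiantsHypothesis.ValiantsHypothesis.Theorems.NewtonUnitEquationsDissociatedUniformTotalsLawUnionVertLowerCluster
import HarnessLib

/-!
# Crux `NewtonUnitEquations.DissociatedUniform` (stmt-ValiantsHypothesis-5905): the pointwise union vertex bound is FALSE —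
# part 3/4, the strict-top certificates of the counterexample family

Parts 1–2 (`…UnionVertLowerGrid`, `…UnionVertLowerCluster`) give the planar inequalities and the cluster structure of the
family `UVBCex` (`G = ℤ/2m × ℤ/8m²`, projective-convexified grid `bC`, far parabola `aC`, anti-parabola position set `Zset`,
class `0`).  This part certifies `4m⁴` hull vertices of `U_0(Z)`; part 4 (`…UnionVertLower`) counts them and concludes
`∀ C, ¬ UnionVertBound C`.
* `xOf u c = (-u, u(k-u) - c)` — the cluster of slope index `u` and offset `c` (`ubar_xOf`, `chat_xOf`); `iOf u j`, the index
  of its line point of column `j`; `bC_cert`: that point is the grid point `(j, 2uj + c)`.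
* `Idx m = [1, m] × [0, 4m²) × [m, 2m)` (`card_Idx : #Idx = 4m⁴`), `vOf t = aC (xOf u c) + gridPt j (2uj + c)`, the weight
  `wOf t = (σ, -1)` with `σ = sig t = 2uP/(P + c) + 2X_j/M` (`sig_bounds`, `excess_bounds`).
* `cross_lt`: every point of ANOTHER cluster scores below `vOf t` (parameter separation `≥ 1/(2P)` + parabola margin
  `32m² = 4K` against the `b`-range `< 3K`); `same_lt`: every other point of the SAME cluster scores below (line points by
  the concave-quadratic score, wrapped points because they lie `≥ 2k` rows above the line); `strict_top`; hence
  `vOf_mem_extremePoints` (via `IsStrictTop.mem_extremePoints`) and `vOf_injOn`.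
Honest label: a refutation tool; `UnionTotalsLaw`, `TotalsLawThree` remain OPEN; nothing here bears on VP ≠ VNP.
[folklore: strict linear maximisers of a finite planar set are hull vertices]
-/

set_option linter.dupNamespace false -- `ValiantsHypothesis.ValiantsHypothesis` (summit = problem) in every name

namespace Summit.ValiantsHypothesis.ValiantsHypothesis.Theorems.NewtonUnitEquationsDissociatedUniform

namespace TotalsLaw

namespace UVBCex

open scoped BigOperators Pointwise

variable (m : ℕ) [NeZero m]

/-! ### The certified clusters `x = (-u, u(k-u) - c)` and their line points -/

/-- The label of the cluster with slope index `u` and offset `c`: `x = (-u, u(k - u) - c)`. -/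
def xOf (u c : ℕ) : Grp m :=
  (-((u : ℕ) : ZMod (2 * m)), (((u : ℤ) * (2 * (m : ℤ) - (u : ℤ)) : ℤ) : ZMod (8 * m ^ 2)) - ((c : ℕ) : ZMod (8 * m ^ 2)))

omit [NeZero m] in
/-- Its slope index is `u`. -/
theorem ubar_xOf (u c : ℕ) (hu : u < 2 * m) : ubar m (xOf m u c) = u := by
  simp only [ubar, xOf, neg_neg, ZMod.val_natCast]
  exact Nat.mod_eq_of_lt hu

omit [NeZero m] in
/-- Its offset is `c`. -/
theorem chat_xOf (u c : ℕ) (hu : u < 2 * m) (hc : c < 8 * m ^ 2) : chat m (xOf m u c) = c := by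
  have h := ubar_xOf m u c hu
  unfold chat
  rw [h]
  have e : -(xOf m u c).2 + (((u : ℤ) * (2 * (m : ℤ) - (u : ℤ)) : ℤ) : ZMod (8 * m ^ 2)) =
      ((c : ℕ) : ZMod (8 * m ^ 2)) := by
    simp only [xOf]; ring
  rw [e, ZMod.val_natCast]
  exact Nat.mod_eq_of_lt hc

/-- The cluster index of the line point of column `j ≥ u`: `i = j - u`. -/
def iOf (u j : ℕ) : ZMod (2 * m) := ((j - u : ℕ) : ZMod (2 * m))

omit [NeZero m] in
/-- Its representative. -/
theorem iOf_val (u j : ℕ) (hj : j < 2 * m) : (iOf m u j).val = j - u := by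
  simp only [iOf, ZMod.val_natCast]
  exact Nat.mod_eq_of_lt (by omega)

/-- **The certified point is in the union**: the partner `yOf (xOf u c) (iOf u j)` is the grid point `(j, 2uj + c)` of the
line of cluster `(u, c)` (`1 ≤ u ≤ m`, `c < 4m²`, `u ≤ j < 2m`). -/
theorem bC_cert (u c j : ℕ) (hum : u ≤ m) (hc : c < 4 * m ^ 2) (huj : u ≤ j) (hj : j < 2 * m) :
    bC m (yOf m (xOf m u c) (iOf m u j)) = gridPt (Pc m) (Mc m) j (2 * u * j + c) := by
  have hu2 : u < 2 * m := by omega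
  have hux := ubar_xOf m u c hu2
  have hcx := chat_xOf m u c hu2 (by nlinarith)
  have hiv := iOf_val m u j hj
  have hlt : (iOf m u j).val + ubar m (xOf m u c) < 2 * m := by rw [hiv, hux]; omega
  obtain ⟨hcol, hrow⟩ := col_row_of_lt m (xOf m u c) (iOf m u j) (by rw [hux]; exact hum) (by rw [hcx]; exact hc) hlt
  rw [hiv, hux] at hcol hrow
  rw [hcx] at hrow
  have hj' : j - u + u = j := by omega
  rw [hj'] at hcol
  unfold bC
  rw [hcol]
  congr 1
  have e1 : ((row m (yOf m (xOf m u c) (iOf m u j)) : ℕ) : ℝ) = (((row m (yOf m (xOf m u c) (iOf m u j)) : ℕ) : ℤ) : ℝ) := by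
    norm_cast
  have e2 : ((j - u : ℕ) : ℤ) + u = j := by exact_mod_cast hj'
  rw [e1, hrow, e2]
  push_cast
  ring

/-! ### The certificates: index set, points, weights -/

/-- The index set `{(u, c, j) : 1 ≤ u ≤ m, c < 4m², m ≤ j < 2m}` of the certified vertices (`4m⁴` of them). -/
def Idx : Finset (ℕ × ℕ × ℕ) := Finset.Icc 1 m ×ˢ (Finset.range (4 * m ^ 2) ×ˢ Finset.Ico m (2 * m))

omit [NeZero m] in
/-- Membership in the index set. -/
theorem mem_Idx {t : ℕ × ℕ × ℕ} :
    t ∈ Idx m ↔ (1 ≤ t.1 ∧ t.1 ≤ m) ∧ t.2.1 < 4 * m ^ 2 ∧ m ≤ t.2.2 ∧ t.2.2 < 2 * m := by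
  simp only [Idx, Finset.mem_product, Finset.mem_Icc, Finset.mem_range, Finset.mem_Ico]

omit [NeZero m] in
/-- `#Idx = 4m⁴`. -/
theorem card_Idx : (Idx m).card = 4 * m ^ 4 := by
  simp only [Idx, Finset.card_product, Nat.card_Icc, Finset.card_range, Nat.card_Ico, Nat.add_sub_cancel]
  have : 2 * m - m = m := by omega
  rw [this]
  ring

/-- The certified vertex of index `(u, c, j)`: `a (xOf u c) + gridPt j (2uj + c)`. -/
noncomputable def vOf (t : ℕ × ℕ × ℕ) : Fin 2 → ℝ :=
  aC m (xOf m t.1 t.2.1) + gridPt (Pc m) (Mc m) t.2.2 (2 * t.1 * t.2.2 + t.2.1)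

/-- The weight slope of index `(u, c, j)`: `σ = 2uP/(P + c) + 2X_j/M`. -/
noncomputable def sig (t : ℕ × ℕ × ℕ) : ℝ :=
  2 * (t.1 : ℝ) * Pc m / (Pc m + t.2.1) + 2 * pX (Pc m) t.2.2 (2 * t.1 * t.2.2 + t.2.1) / Mc m

/-- The certifying weight `(σ, -1)`. -/
noncomputable def wOf (t : ℕ × ℕ × ℕ) : Fin 2 → ℝ := ![sig m t, -1]

/-- The certified vertex lies in class `0`. -/
theorem vOf_mem {t : ℕ × ℕ × ℕ} (ht : t ∈ Idx m) : vOf m t ∈ unionPts (aC m) (bC m) (Zset m) 0 := by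
  obtain ⟨⟨hu1, hum⟩, hc, hmj, hj⟩ := (mem_Idx m).1 ht
  have h := mem_U m (xOf m t.1 t.2.1) (iOf m t.1 t.2.2)
  rwa [bC_cert m t.1 t.2.1 t.2.2 hum hc (by omega) hj] at h

/-! ### Numerical facts about the parameters -/

omit [NeZero m] in
/-- `tpar P u c` is the first summand of `σ`. -/
theorem tpar_eq (u c : ℕ) : tpar (Pc m) u c = 2 * (u : ℝ) * Pc m / (Pc m + c) := rfl

/-- `1 ≤ m` as a real. -/
theorem one_le_m : (1 : ℝ) ≤ m := by exact_mod_cast Nat.one_le_iff_ne_zero.2 (NeZero.ne m)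

/-- `(2m)² ≤ M`. -/
theorem ksq_le_M : (2 * (m : ℝ)) ^ 2 ≤ Mc m := by
  have hm := one_le_m m
  have h4 : (m : ℝ) ^ 2 ≤ (m : ℝ) ^ 4 := pow_le_pow_right₀ hm (by norm_num)
  unfold Mc; nlinarith

/-- `4(2m)² ≤ M`. -/
theorem four_ksq_le_M : 4 * (2 * (m : ℝ)) ^ 2 ≤ Mc m := by
  have hm := one_le_m m
  have h4 : (m : ℝ) ^ 2 ≤ (m : ℝ) ^ 4 := pow_le_pow_right₀ hm (by norm_num)
  unfold Mc; nlinarith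

/-- `8m² ≤ P` and `1 ≤ P`. -/
theorem K_le_P : 8 * (m : ℝ) ^ 2 ≤ Pc m ∧ 1 ≤ Pc m := by
  have hm := one_le_m m
  have h3 : (m : ℝ) ^ 2 ≤ (m : ℝ) ^ 3 := pow_le_pow_right₀ hm (by norm_num)
  have h1 : (1 : ℝ) ≤ (m : ℝ) ^ 2 := one_le_pow₀ hm
  unfold Pc
  exact ⟨by nlinarith, by nlinarith⟩

/-- The excess `σ − t_x = 2X_j/M` lies in `[0, 1/(8P)]` for `j < 2m`. -/
theorem excess_bounds {u c j : ℕ} (hj : j < 2 * m) :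
    0 ≤ 2 * pX (Pc m) j (2 * u * j + c) / Mc m ∧ 2 * pX (Pc m) j (2 * u * j + c) / Mc m ≤ 1 / (8 * Pc m) := by
  have hm := one_le_m m
  have hP := Pc_pos m
  have hM := Mc_pos m
  have hX0 : 0 ≤ pX (Pc m) j (2 * u * j + c) := pX_nonneg hP (Nat.cast_nonneg _) (by positivity)
  have hXle : pX (Pc m) j (2 * u * j + c) ≤ 2 * m := by
    have h1 := pX_le hP (Nat.cast_nonneg j) (show (0 : ℝ) ≤ 2 * u * j + c by positivity)
    have h2 : (j : ℝ) ≤ 2 * m := by exact_mod_cast hj.le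
    linarith
  refine ⟨by positivity, ?_⟩
  set X := pX (Pc m) j (2 * u * j + c) with hX
  rw [div_le_div_iff₀ hM (by positivity)]
  have eP : Pc m = 32 * (m : ℝ) ^ 3 := rfl
  have eM : Mc m = 1024 * (m : ℝ) ^ 4 := rfl
  rw [eP, eM]
  have h3 : (0 : ℝ) ≤ 512 * (m : ℝ) ^ 3 := by positivity
  nlinarith [mul_le_mul_of_nonneg_left hXle h3]

/-- `0 ≤ σ ≤ 2m + 1` on the index set. -/
theorem sig_bounds {t : ℕ × ℕ × ℕ} (ht : t ∈ Idx m) : 0 ≤ sig m t ∧ sig m t ≤ 2 * m + 1 := by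
  obtain ⟨⟨hu1, hum⟩, hc, hmj, hj⟩ := (mem_Idx m).1 ht
  have hP := Pc_pos m
  obtain ⟨e0, e1⟩ := excess_bounds m (u := t.1) (c := t.2.1) hj
  have ht0 : 0 ≤ tpar (Pc m) t.1 t.2.1 := tpar_nonneg hP (Nat.cast_nonneg _) (Nat.cast_nonneg _)
  have ht1 : tpar (Pc m) t.1 t.2.1 ≤ 2 * t.1 := tpar_le hP (Nat.cast_nonneg _) (Nat.cast_nonneg _)
  have hum' : (t.1 : ℝ) ≤ m := by exact_mod_cast hum
  have hP1 : 1 / (8 * Pc m) ≤ 1 := by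
    rw [div_le_one (by positivity)]
    linarith [(K_le_P m).2]
  rw [sig, ← tpar_eq]
  exact ⟨by linarith, by linarith⟩

/-! ### The cross-cluster inequality: the weight of index `(u, c, j)` selects cluster `xOf u c` with margin -/

omit [NeZero m] in
/-- The score of the certified vertex. -/
theorem dot_vOf (t : ℕ × ℕ × ℕ) :
    wOf m t ⬝ᵥ vOf m t = Lc m * (sig m t * tpar (Pc m) (ubar m (xOf m t.1 t.2.1)) (chat m (xOf m t.1 t.2.1)) -
        tpar (Pc m) (ubar m (xOf m t.1 t.2.1)) (chat m (xOf m t.1 t.2.1)) ^ 2 / 2) +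
      gval (Pc m) (Mc m) (sig m t) t.2.2 (2 * t.1 * t.2.2 + t.2.1) := by
  rw [vOf, wOf, dotProduct_add, dot_aC, dot_gridPt]

/-- **Cross-cluster**: every point of another cluster scores strictly below the certified vertex. -/
theorem cross_lt {t : ℕ × ℕ × ℕ} (ht : t ∈ Idx m) {x' : Grp m} (hx' : x' ≠ xOf m t.1 t.2.1) (y' : Grp m) :
    wOf m t ⬝ᵥ (aC m x' + bC m y') < wOf m t ⬝ᵥ vOf m t := by
  obtain ⟨⟨hu1, hum⟩, hc, hmj, hj⟩ := (mem_Idx m).1 ht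
  have hm := one_le_m m
  have hP := Pc_pos m
  have hM := Mc_pos m
  have hu2 : t.1 < 2 * m := by omega
  have hux := ubar_xOf m t.1 t.2.1 hu2
  have hcx := chat_xOf m t.1 t.2.1 hu2 (by nlinarith)
  obtain ⟨hσ0, hσ1⟩ := sig_bounds m ht
  rw [dot_vOf, hux, hcx, wOf, dotProduct_add, dot_aC]
  -- the `A` margin
  obtain ⟨e0, e1⟩ := excess_bounds m (u := t.1) (c := t.2.1) hj
  have hne : (t.1, t.2.1) ≠ (ubar m x', chat m x') := by
    intro h
    apply hx'
    obtain ⟨h1, h2⟩ := Prod.mk.inj h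
    exact eq_of_ubar_eq_of_chat_eq m (by rw [hux, h1]) (by rw [hcx, h2])
  obtain ⟨hK8, hP1⟩ := K_le_P m
  have hsep := param_sep (P := Pc m) (K := 8 * (m : ℝ) ^ 2) hP1 hK8 hu1
    (by have : (t.2.1 : ℝ) ≤ 4 * m ^ 2 := by exact_mod_cast hc.le
        nlinarith)
    (by exact_mod_cast (chat_lt m x').le)
    (by have : (t.1 : ℝ) ≤ m := by exact_mod_cast hum
        unfold Pc; nlinarith [pow_pos (by linarith : (0 : ℝ) < m) 2])
    (by have : (ubar m x' : ℝ) ≤ 2 * m := by exact_mod_cast (ubar_lt m x').le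
        unfold Pc; nlinarith [pow_pos (by linarith : (0 : ℝ) < m) 2])
    hne
  have hgap := apt_gap (Λ := Lc m) (σ := sig m t) (t := tpar (Pc m) t.1 t.2.1)
    (t' := tpar (Pc m) (ubar m x') (chat m x')) (δ := 1 / (8 * Pc m)) (Δ := 1 / (2 * Pc m))
    (by unfold Lc; positivity)
    (by rw [sig, ← tpar_eq]; linarith) (by rw [sig, ← tpar_eq]; linarith)
    (by rw [div_le_div_iff₀ (by positivity) (by positivity)]; nlinarith) hsep
  have hgapval : Lc m / 2 * ((1 / (2 * Pc m) - 1 / (8 * Pc m)) ^ 2 - (1 / (8 * Pc m)) ^ 2) = 32 * (m : ℝ) ^ 2 := by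
    unfold Lc Pc
    have : (m : ℝ) ≠ 0 := by positivity
    field_simp
    ring
  rw [hgapval] at hgap
  -- the `B` parts
  obtain ⟨-, hB'⟩ := dot_bC_bounds m hσ0 y'
  have hjle : (t.2.2 : ℝ) ≤ 2 * m := by exact_mod_cast hj.le
  have hrow : (2 * t.1 * t.2.2 + t.2.1 : ℝ) ≤ 8 * (m : ℝ) ^ 2 := by
    have h1 : (t.1 : ℝ) ≤ m := by exact_mod_cast hum
    have h2 : (t.2.1 : ℝ) ≤ 4 * m ^ 2 := by exact_mod_cast hc.le
    nlinarith
  have hB := neg_le_gval (K := 8 * (m : ℝ) ^ 2) (k := 2 * (m : ℝ)) hP hM hσ0 (Nat.cast_nonneg _) hjle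
    (by positivity) hrow (ksq_le_M m)
  nlinarith

/-! ### Within the cluster: the other points of cluster `xOf u c` score strictly below -/

/-- **Same cluster**: a point of cluster `xOf u c` other than the certified vertex scores strictly below it. -/
theorem same_lt {t : ℕ × ℕ × ℕ} (ht : t ∈ Idx m) (i' : ZMod (2 * m))
    (hne : aC m (xOf m t.1 t.2.1) + bC m (yOf m (xOf m t.1 t.2.1) i') ≠ vOf m t) :
    wOf m t ⬝ᵥ (aC m (xOf m t.1 t.2.1) + bC m (yOf m (xOf m t.1 t.2.1) i')) < wOf m t ⬝ᵥ vOf m t := by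
  obtain ⟨⟨hu1, hum⟩, hc, hmj, hj⟩ := (mem_Idx m).1 ht
  have hm := one_le_m m
  have hP := Pc_pos m
  have hM := Mc_pos m
  have hu2 : t.1 < 2 * m := by omega
  set x := xOf m t.1 t.2.1 with hx
  have hux : ubar m x = t.1 := ubar_xOf m t.1 t.2.1 hu2
  have hcx : chat m x = t.2.1 := chat_xOf m t.1 t.2.1 hu2 (by nlinarith)
  have hum' : ubar m x ≤ m := by rw [hux]; exact hum
  have hc' : chat m x < 4 * m ^ 2 := by rw [hcx]; exact hc
  obtain ⟨hσ0, -⟩ := sig_bounds m ht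
  rw [vOf, wOf, dotProduct_add, dotProduct_add, add_lt_add_iff_left, dot_bC, dot_gridPt]
  rcases lt_or_wrap m x i' with hlt | ⟨c', hcw⟩
  · -- no wrap: a point of the line, of a different column
    obtain ⟨hcol, hrow⟩ := col_row_of_lt m x i' hum' hc' hlt
    rw [hux] at hcol hrow
    rw [hcx] at hrow
    set j' : ℕ := i'.val + t.1 with hj'
    have hjj : j' ≠ t.2.2 := by
      intro hjj
      apply hne
      rw [vOf]
      congr 1
      unfold bC
      rw [hcol, hjj]
      congr 1
      have e1 : ((row m (yOf m x i') : ℕ) : ℝ) = (((row m (yOf m x i') : ℕ) : ℤ) : ℝ) := by norm_cast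
      rw [e1, hrow]
      push_cast
      have : (i'.val : ℝ) + t.1 = t.2.2 := by exact_mod_cast hjj
      rw [this]
    have hrowR : ((row m (yOf m x i') : ℕ) : ℝ) = 2 * (t.1 : ℝ) * (j' : ℝ) + t.2.1 := by
      have e1 : ((row m (yOf m x i') : ℕ) : ℝ) = (((row m (yOf m x i') : ℕ) : ℤ) : ℝ) := by norm_cast
      rw [e1, hrow, hj']; push_cast; ring
    rw [hcol, hrowR, sig]
    have := gval_chain_lt (P := Pc m) (M := Mc m) (u := (t.1 : ℝ)) (c := (j' : ℝ)) (c₀ := (t.2.2 : ℝ))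
      (c₁ := (t.2.1 : ℝ)) hP hM (Nat.cast_nonneg _) (Nat.cast_nonneg _) (Nat.cast_nonneg _) (Nat.cast_nonneg _)
      (by exact_mod_cast hjj)
    convert this using 2
  · -- wrap: a point strictly above the line, on a column `< u`
    obtain ⟨hcol, hcu, hrow⟩ := col_row_of_ge m x i' hum' hc' c' hcw
    rw [hux] at hcu hrow
    rw [hcx] at hrow
    have hrowR : ((row m (yOf m x i') : ℕ) : ℝ) =
        (2 * (t.1 : ℝ) * c' + t.2.1) + 4 * (m : ℝ) * ((t.1 : ℝ) - c') := by
      have e1 : ((row m (yOf m x i') : ℕ) : ℝ) = (((row m (yOf m x i') : ℕ) : ℤ) : ℝ) := by norm_cast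
      rw [e1, hrow]; push_cast; ring
    rw [hcol, hrowR]
    have hcu' : (c' : ℝ) + 1 ≤ t.1 := by exact_mod_cast hcu
    have hum'' : (t.1 : ℝ) ≤ m := by exact_mod_cast hum
    have hcR : (t.2.1 : ℝ) ≤ 4 * m ^ 2 := by exact_mod_cast hc.le
    have hc'm : (c' : ℝ) ≤ m := by linarith
    have hp1 : (t.1 : ℝ) * c' ≤ m * m := mul_le_mul hum'' hc'm (Nat.cast_nonneg _) (by linarith)
    have hp2 : (m : ℝ) * ((t.1 : ℝ) - c') ≤ m * m := mul_le_mul_of_nonneg_left (by linarith) (by linarith)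
    have hrdP : 2 * (t.1 : ℝ) * c' + t.2.1 + 4 * (m : ℝ) * ((t.1 : ℝ) - c') ≤ Pc m := by
      have h3 : (m : ℝ) ^ 2 ≤ (m : ℝ) ^ 3 := pow_le_pow_right₀ hm (by norm_num)
      unfold Pc; nlinarith
    have h1 := gval_lt_of_row_add (P := Pc m) (M := Mc m) (σ := sig m t) (c := (c' : ℝ))
      (r := 2 * (t.1 : ℝ) * c' + t.2.1) (d := 4 * (m : ℝ) * ((t.1 : ℝ) - c')) (k := 2 * (m : ℝ)) hP hM hσ0
      (by linarith) (Nat.cast_nonneg _) (by linarith) (by positivity) (by nlinarith) hrdP (four_ksq_le_M m)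
    have h2 := gval_chain_le (P := Pc m) (M := Mc m) (u := (t.1 : ℝ)) (c := (c' : ℝ)) (c₀ := (t.2.2 : ℝ))
      (c₁ := (t.2.1 : ℝ)) hP hM (Nat.cast_nonneg _) (Nat.cast_nonneg _) (Nat.cast_nonneg _) (Nat.cast_nonneg _)
    rw [sig] at h1 ⊢
    exact lt_of_lt_of_le h1 h2

/-! ### Strict tops, hence hull vertices -/

/-- **The certified vertex is the strict top of class `0` for its weight.** -/
theorem strict_top {t : ℕ × ℕ × ℕ} (ht : t ∈ Idx m) (p : Fin 2 → ℝ)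
    (hp : p ∈ unionPts (aC m) (bC m) (Zset m) 0) (hne : p ≠ vOf m t) : wOf m t ⬝ᵥ p < wOf m t ⬝ᵥ vOf m t := by
  obtain ⟨x', i', rfl⟩ := (mem_U_iff m p).1 hp
  by_cases hx : x' = xOf m t.1 t.2.1
  · subst hx
    exact same_lt m ht i' hne
  · exact cross_lt m ht hx _

/-- Hence it is a hull vertex of class `0`. -/
theorem vOf_mem_extremePoints {t : ℕ × ℕ × ℕ} (ht : t ∈ Idx m) :
    vOf m t ∈ (convexHull ℝ (unionPts (aC m) (bC m) (Zset m) 0)).extremePoints ℝ := by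
  have hst : Literature.Computability.AlgebraicComplexity.KPTT.PlanarMinkowski.IsStrictTop (wOf m t)
      (unionFin (aC m) (bC m) (Zset m) 0) (vOf m t) := by
    refine ⟨?_, fun y hy hne => ?_⟩
    · rw [← Finset.mem_coe, coe_unionFin]; exact vOf_mem m ht
    · rw [← Finset.mem_coe, coe_unionFin] at hy; exact strict_top m ht y hy hne
  rw [← coe_unionFin (aC m) (bC m) (Zset m) 0]
  exact hst.mem_extremePoints

/-- The certified vertices are pairwise distinct. -/
theorem vOf_injOn : Set.InjOn (vOf m) (Idx m : Set (ℕ × ℕ × ℕ)) := by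
  intro t ht t' ht' h
  have ht0 := Finset.mem_coe.1 ht
  have ht0' := Finset.mem_coe.1 ht'
  obtain ⟨⟨hu1, hum⟩, hc, hmj, hj⟩ := (mem_Idx m).1 ht0
  obtain ⟨⟨hu1', hum'⟩, hc', hmj', hj'⟩ := (mem_Idx m).1 ht0'
  have hP := Pc_pos m
  by_cases huc : (t.1, t.2.1) = (t'.1, t'.2.1)
  · obtain ⟨h1, h2⟩ := Prod.mk.inj huc
    have h3 : t.2.2 = t'.2.2 := by
      by_contra hjj
      have hg : gridPt (Pc m) (Mc m) t.2.2 (2 * t.1 * t.2.2 + t.2.1) = gridPt (Pc m) (Mc m) t'.2.2 (2 * t'.1 * t'.2.2 + t'.2.1) := by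
        have := h
        rw [vOf, vOf, ← h1, ← h2] at this
        rw [← h1, ← h2]
        exact add_left_cancel this
      have hX := congrFun hg 0
      simp only [gridPt, Matrix.cons_val_zero] at hX
      rw [← h1, ← h2] at hX
      exact pX_chain_ne (P := Pc m) (u := (t.1 : ℝ)) (c₁ := (t.2.1 : ℝ)) hP (Nat.cast_nonneg _) (Nat.cast_nonneg t.2.2)
        (Nat.cast_nonneg t'.2.2) (Nat.cast_nonneg _) (by exact_mod_cast hjj) hX
    exact Prod.ext h1 (Prod.ext h2 h3)
  · exfalso
    have hx' : xOf m t'.1 t'.2.1 ≠ xOf m t.1 t.2.1 := by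
      intro e
      apply huc
      have hu2 : t.1 < 2 * m := by omega
      have hu2' : t'.1 < 2 * m := by omega
      have e1 : t'.1 = t.1 := by
        rw [← ubar_xOf m t.1 t.2.1 hu2, ← ubar_xOf m t'.1 t'.2.1 hu2', e]
      have e2 : t'.2.1 = t.2.1 := by
        rw [← chat_xOf m t.1 t.2.1 hu2 (by nlinarith), ← chat_xOf m t'.1 t'.2.1 hu2' (by nlinarith), e]
      rw [e1, e2]
    have hlt := cross_lt m ht0 hx' (yOf m (xOf m t'.1 t'.2.1) (iOf m t'.1 t'.2.2))
    rw [bC_cert m t'.1 t'.2.1 t'.2.2 hum' hc' (by omega) hj', ← vOf, h] at hlt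
    exact lt_irrefl _ hlt

end UVBCex

end TotalsLaw

end Summit.ValiantsHypothesis.ValiantsHypothesis.Theorems.NewtonUnitEquationsDissociatedUniform
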